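import Literature.Combinatorics.Optimization.RosenbergQuadratization
import Mathlib.Algebra.BigOperators.Ring.Finset
import Mathlib.Algebra.Order.BigOperators.Group.Finset
import HarnessLib

/-!
# Termwise (penalty-free) quadratizations of monomials: Kolmogorov–Zabih / Freedman–Drineas and Ishikawa

Boros–Gruber, *On quadratization of pseudo-Boolean functions*, arXiv:1404.6538 [BorosGruber2014], §2.1
(Literature Review), p. 4–5, quoting [KZ04] Kolmogorov–Zabih, IEEE TPAMI 26 (2004) 147–159, [FD05]
Freedman–Drineas, CVPR 2005, pp. 939–946, and [Ish11] Ishikawa, IEEE TPAMI 33 (2011) 1234–1249: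

* (e-KZFD) "A simple quadratization of negative monomials was introduced recently by [KZ04] for degree 3
  monomials, and by [FD05] for arbitrary degree monomials.
  `−x_1 x_2 ⋯ x_d = min_{w ∈ 𝔹} w((d − 1) − Σ_{j=1}^d x_j)`.
  Remarkably, all quadratic terms have negative coefficients in this transformation. … It is also a nice
  feature of this approach that it does not introduces “large” coefficients."
* "this transformation can be extended easily for positive monomials, as well … introducing negated literals
  `x̄_i = 1 − x_i` we can write
  `x_1 x_2 ⋯ x_d − x_{d−1} x_d = −Σ_{i=1}^{d−2} x̄_i ∏_{j=i+1}^d x_j = min_{w ∈ 𝔹^{d−2}} Σ_{i=1}^{d−2} w_i(d − i − x̄_i − Σ_{j=i+1}^d x_j)`.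
  … For a degree d term we need d − 2 new variables and get d − 1 positive (non-submodular) quadratic terms."
* ([Ish11]) "consider the positive term `t(x) = x_1 x_2 ⋯ x_d` of degree d, set `k = ⌊(d−1)/2⌋`, and consider
  new binary variables `w = (w_1, …, w_k)`. Define `S_1 = Σ_j x_j`, `S_2 = Σ_{i<j} x_i x_j`, `A = Σ_j w_j` and
  `B = Σ_j (4j − 1) w_j`. Then … `∏ x_j = S_2 + min_{w ∈ 𝔹^k} B − 2A S_1` if `d = 2k + 2`, and
  `∏ x_j = S_2 + min_{w ∈ 𝔹^k} B − 2A S_1 + w_k(S_1 − d + 1)` if `d = 2k + 1`."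

These are the PENALTY-FREE alternatives to Rosenberg's substitution (`RosenbergQuadratization.lean`): each
monomial is replaced by a quadratic function of the old variables and one (or ⌊(d−1)/2⌋) new variable(s)
whose MINIMUM over the new variables equals the monomial identically — no penalty weight `M` is involved.

## Contents (Boolean arguments, values in a linear ordered commutative ring `R`; `bit` from the Rosenberg file;
"`min_{w ∈ 𝔹} w·c`" is written `min 0 c`, justified by `min_bit_mul`)

* `min_bit_mul` — `min over w ∈ 𝔹 of (bit w)·c = min 0 c`.
* **`neg_prod_bit_eq_min`** — (e-KZFD) for an arbitrary finite index type: `−∏ x_i = min 0 ((d − 1) − Σ x_i)`,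
  `d` the number of variables; `kzfd_cubic` the degree-3 instance `−x₁x₂x₃ = min 0 (2 − x₁ − x₂ − x₃)`.
* `pos_cubic_eq_min` — the positive degree-3 case of the negated-literal display (`d − 2 = 1` new variable):
  `x₁x₂x₃ = x₂x₃ + min 0 (1 + x₁ − x₂ − x₃)` (from `2 − x̄₁ − x₂ − x₃ = 1 + x₁ − x₂ − x₃`).
* `ishikawa_cubic` (`d = 3 = 2k + 1`, `k = 1`: `B − 2AS_1 + w_k(S_1 − d + 1) = w(1 − S_1)`):
  `x₁x₂x₃ = S_2 + min 0 (1 − S_1)`; `ishikawa_quartic` (`d = 4 = 2k + 2`, `k = 1`: `B − 2AS_1 = w(3 − 2S_1)`):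
  `x₁x₂x₃x₄ = S_2 + min 0 (3 − 2S_1)`.

HONEST FRAMING: elementary identities transcribed from the cited survey (instance-level vocabulary for the
HUBO → QUBO baselines of CLAIMS E-29 / E-42 / E-43 of the pub-qadeq cell); nothing here concerns any solver,
running time, BQP vs BPP or the QuantumAdvantage summit.
-/


namespace Literature.Combinatorics.Optimization

namespace Termwise

open Finset Rosenberg

variable {R : Type*} [CommRing R] [LinearOrder R] [IsStrictOrderedRing R]

omit [IsStrictOrderedRing R] in
/-- "`min_{w ∈ 𝔹} w·c`": minimising `(bit w)·c` over the one new binary variable gives `min 0 c`.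
[cite: BorosGruber2014, §2.1 (e-KZFD) ("min_{w ∈ 𝔹} w(⋯)")] -/
theorem min_bit_mul (c : R) : min ((bit false : R) * c) ((bit true : R) * c) = min 0 c := by
  simp

omit [LinearOrder R] [IsStrictOrderedRing R] in
/-- The product of the bits is `1` if all are `true` and `0` otherwise. [folklore] -/
private theorem prod_bit_eq {ι : Type*} [Fintype ι] (x : ι → Bool) :
    (∏ i, (bit (x i) : R)) = if ∀ i, x i = true then 1 else 0 := by
  split_ifs with h
  · exact Finset.prod_eq_one (fun i _ => by simp [h i])
  · push Not at h
    obtain ⟨i, hi⟩ := h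
    exact Finset.prod_eq_zero (Finset.mem_univ i) (by simp [Bool.eq_false_iff.mpr hi])

/-- The sum of the bits is at most the number of variables, … [folklore] -/
private theorem sum_bit_le_card {ι : Type*} [Fintype ι] (x : ι → Bool) :
    (∑ i, (bit (x i) : R)) ≤ Fintype.card ι := by
  calc (∑ i, (bit (x i) : R)) ≤ ∑ _i : ι, (1 : R) :=
        Finset.sum_le_sum (fun i _ => by cases x i <;> simp)
    _ = Fintype.card ι := by simp

/-- … and at most that number minus one as soon as one bit is `false`. [folklore] -/
private theorem sum_bit_le_card_sub_one {ι : Type*} [Fintype ι] [DecidableEq ι] (x : ι → Bool) {i₀ : ι}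
    (h : x i₀ = false) : (∑ i, (bit (x i) : R)) ≤ Fintype.card ι - 1 := by
  classical
  have hsplit := Finset.sum_erase_add (Finset.univ) (fun i => (bit (x i) : R)) (Finset.mem_univ i₀)
  have hle : (∑ i ∈ Finset.univ.erase i₀, (bit (x i) : R)) ≤ ∑ _i ∈ Finset.univ.erase i₀, (1 : R) :=
    Finset.sum_le_sum (fun i _ => by cases x i <;> simp)
  have hcard : (∑ _i ∈ Finset.univ.erase i₀, (1 : R)) = Fintype.card ι - 1 := by
    rw [Finset.sum_const, Finset.card_erase_of_mem (Finset.mem_univ i₀), Finset.card_univ, nsmul_eq_mul,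
      mul_one]
    have : 1 ≤ Fintype.card ι := Fintype.card_pos_iff.mpr ⟨i₀⟩
    push_cast [Nat.cast_sub this]
    ring
  rw [← hsplit, h, bit_false, add_zero]
  exact hle.trans hcard.le

/-- **(e-KZFD), Kolmogorov–Zabih / Freedman–Drineas**: for binary `x_1, …, x_d`,
`−x_1 x_2 ⋯ x_d = min_{w ∈ 𝔹} w((d − 1) − Σ_j x_j)`. [cite: BorosGruber2014, §2.1 eq. (e-KZFD), p. 5]
[cite: FreedmanDrineas2005] [cite: KolmogorovZabih2004] -/
theorem neg_prod_bit_eq_min {ι : Type*} [Fintype ι] [DecidableEq ι] (x : ι → Bool) :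
    -(∏ i, (bit (x i) : R)) = min 0 ((Fintype.card ι - 1 : R) - ∑ i, bit (x i)) := by
  rw [prod_bit_eq]
  split_ifs with h
  · have hsum : (∑ i, (bit (x i) : R)) = Fintype.card ι := by
      rw [Finset.sum_congr rfl (fun i _ => by rw [h i, bit_true]), Finset.sum_const, Finset.card_univ,
        nsmul_eq_mul, mul_one]
    rw [hsum, min_eq_right (by linarith)]
    ring
  · push Not at h
    obtain ⟨i₀, hi₀⟩ := h
    have := sum_bit_le_card_sub_one (R := R) x (Bool.eq_false_iff.mpr hi₀)
    rw [min_eq_left (by linarith), neg_zero]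

/-- The degree-3 instance of (e-KZFD): `−x₁x₂x₃ = min_{w} w(2 − x₁ − x₂ − x₃)`.
[cite: BorosGruber2014, §2.1 eq. (e-KZFD) with d = 3 ([KZ04])] -/
theorem kzfd_cubic (x₁ x₂ x₃ : Bool) :
    -((bit x₁ : R) * bit x₂ * bit x₃) = min 0 (2 - ((bit x₁ : R) + bit x₂ + bit x₃)) := by
  cases x₁ <;> cases x₂ <;> cases x₃ <;> norm_num

/-- **Positive cubic monomial with ONE new variable and no penalty weight** (the negated-literal display
of [BorosGruber2014] with `d = 3`, `d − 2 = 1`): `x₁x₂x₃ − x₂x₃ = −x̄₁x₂x₃ = min_w w(2 − x̄₁ − x₂ − x₃)`,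
i.e. `x₁x₂x₃ = x₂x₃ + min 0 (1 + x₁ − x₂ − x₃)`. [cite: BorosGruber2014, §2.1 (display after (e-KZFD)), p. 5] -/
theorem pos_cubic_eq_min (x₁ x₂ x₃ : Bool) :
    (bit x₁ : R) * bit x₂ * bit x₃ = bit x₂ * bit x₃ + min 0 (1 + (bit x₁ : R) - bit x₂ - bit x₃) := by
  cases x₁ <;> cases x₂ <;> cases x₃ <;> norm_num

/-- **Ishikawa, d = 3** (`k = 1`, odd case `B − 2AS_1 + w_k(S_1 − d + 1) = 3w − 2wS_1 + w(S_1 − 2) = w(1 − S_1)`):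
`x₁x₂x₃ = S_2 + min_w w(1 − S_1)` with `S_1 = x₁ + x₂ + x₃`, `S_2 = x₁x₂ + x₁x₃ + x₂x₃`.
[cite: BorosGruber2014, §2.1 (Ishikawa's equalities, case d = 2k + 1), p. 5] [cite: Ishikawa2011] -/
theorem ishikawa_cubic (x₁ x₂ x₃ : Bool) :
    (bit x₁ : R) * bit x₂ * bit x₃ =
      ((bit x₁ : R) * bit x₂ + bit x₁ * bit x₃ + bit x₂ * bit x₃) +
        min 0 (1 - ((bit x₁ : R) + bit x₂ + bit x₃)) := by
  cases x₁ <;> cases x₂ <;> cases x₃ <;> norm_num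

omit [LinearOrder R] [IsStrictOrderedRing R] in
/-- The printed odd-case expression specialises as claimed: for `d = 3`, `k = 1`,
`B − 2AS_1 + w_k(S_1 − d + 1) = (4·1 − 1)w − 2wS_1 + w(S_1 − 2) = w(1 − S_1)`.
[cite: BorosGruber2014, §2.1 (definitions of S_1, A, B), p. 5] -/
theorem ishikawa_cubic_aux (w S₁ : R) : (4 * 1 - 1) * w - 2 * w * S₁ + w * (S₁ - 3 + 1) = w * (1 - S₁) := by
  ring

/-- **Ishikawa, d = 4** (`k = 1`, even case `B − 2AS_1 = w(3 − 2S_1)`): `x₁x₂x₃x₄ = S_2 + min_w w(3 − 2S_1)`.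
[cite: BorosGruber2014, §2.1 (Ishikawa's equalities, case d = 2k + 2), p. 5] [cite: Ishikawa2011] -/
theorem ishikawa_quartic (x₁ x₂ x₃ x₄ : Bool) :
    (bit x₁ : R) * bit x₂ * bit x₃ * bit x₄ =
      ((bit x₁ : R) * bit x₂ + bit x₁ * bit x₃ + bit x₁ * bit x₄ + bit x₂ * bit x₃ + bit x₂ * bit x₄ +
          bit x₃ * bit x₄) +
        min 0 (3 - 2 * ((bit x₁ : R) + bit x₂ + bit x₃ + bit x₄)) := by
  cases x₁ <;> cases x₂ <;> cases x₃ <;> cases x₄ <;> norm_num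

/-- Contrast with Rosenberg's substitution (same cubic term `v·x₁x₂x₃`, `v < 0`): (e-KZFD) quadratizes it
EXACTLY with one new variable and coefficients of size `∣v∣` only — `v·x₁x₂x₃ = min_w ∣v∣·w(2 − x₁ − x₂ − x₃)`
— whereas `Rosenberg.min_cubicTerm_eq` needs a penalty weight `M > ∣v∣`. [cite: BorosGruber2014, §2.1
("it does not introduces “large” coefficients")] -/
theorem neg_cubicTerm_eq_min {v : R} (hv : v ≤ 0) (x₁ x₂ x₃ : Bool) :
    v * ((bit x₁ : R) * bit x₂ * bit x₃) = min 0 ((-v) * (2 - ((bit x₁ : R) + bit x₂ + bit x₃))) := by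
  have h := kzfd_cubic (R := R) x₁ x₂ x₃
  have key : v * ((bit x₁ : R) * bit x₂ * bit x₃) = (-v) * -((bit x₁ : R) * bit x₂ * bit x₃) := by ring
  rw [key, h, mul_min_of_nonneg _ _ (neg_nonneg.mpr hv), mul_zero]

end Termwise

end Literature.Combinatorics.Optimization
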